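import Mathlib
import HarnessLib
import Summits.AtomisticToContinuum.Crystallization.Theorems.FrustratedLawDichotomyAperiodicFrustratedLawGapErgodicCampbellWeight

/-!
# Ergodic reduction for the crux `AperiodicFrustratedLawGap` — matrix elements of the lazy re-rooting operator

Route `FrustratedLawDichotomy`, crux `AperiodicFrustratedLawGap` (item `stmt-AtomisticToContinuum-27623`),
registered stub `stub_ergodicReduction` (skeleton `dd3251ad731e`); sixth brick of step D5 (`hErg`; evidence
`D5-PLAN.md`, "Refinement of D5c").  The lazy re-rooting operator
`(P f)(S) = Σ_{y∈S} w(y) f(S−y) + (1 − Σ_{y∈S} w(y)) f(S)` of `…ErgodicLazyOperator` is the fibre integral of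
`f ∘ p₁ ∘ Θ` against the Campbell weight `W(S,y) = w(y) + (1 − Σ_z w(z)) 1[y=0]` of `…ErgodicCampbellWeight`, and
its matrix elements against `ν` are integrals over the weighted Campbell measure `π = (ν ⊗ₘ κ₀).withDensity W`:

* `lintegral_campbellWeight_mul_reroot` — `Σ_{y∈S} W(S,y) f((Θ(S,y)).1) = (P f)(S)` (the lazy mass sits on the
  root, `Θ(S,0) = (S,0)`);
* `lintegral_mul_lazyReroot_eq_lintegral_withDensity` — `∫ g · P f dν = ∫ g(p.1) f((Θ p).1) dπ(p)`, i.e.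
  `⟨g, P f⟩_{L²(ν)} = ⟨g ∘ p₁, (f ∘ p₁) ∘ Θ⟩_{L²(π)}`: the operator identity `P = E† U E` at the level of
  nonnegative measurable functions.

`[folklore]`.
-/

noncomputable section

namespace Summit.AtomisticToContinuum.Crystallization.Theorems.FrustratedLawDichotomyErgodicReduction

open MeasureTheory Set Filter ProbabilityTheory
open scoped ENNReal Classical
open Literature.Probability.Process (LocalConfig)
open Literature.Probability.Process.LocalConfig (RootedHardCoreConfig toMeasure_def measurable_toMeasure)
open Summit.AtomisticToContinuum.Crystallization.Theorems.BenjaminiSchrammLimit (isSFiniteKernel_toMeasure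
  measurable_reroot)

variable {δ : ℝ}

/-- Integrating against the root's unit mass: `∫ 1[y = 0] h(y) d(count|S)(y) = h(0)` for a rooted
configuration. [folklore] -/
theorem lintegral_indicator_zero_mul (S : RootedHardCoreConfig (EuclideanSpace ℝ (Fin 3)) δ)
    (h : EuclideanSpace ℝ (Fin 3) → ℝ≥0∞) :
    ∫⁻ y, ({(0 : EuclideanSpace ℝ (Fin 3))} : Set (EuclideanSpace ℝ (Fin 3))).indicator (fun _ => (1 : ℝ≥0∞)) y * h y
      ∂((S.1 : LocalConfig (EuclideanSpace ℝ (Fin 3))).toMeasure) = h 0 := by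
  have hrw : (fun y => ({(0 : EuclideanSpace ℝ (Fin 3))} : Set (EuclideanSpace ℝ (Fin 3))).indicator
      (fun _ => (1 : ℝ≥0∞)) y * h y) =
      ({(0 : EuclideanSpace ℝ (Fin 3))} : Set (EuclideanSpace ℝ (Fin 3))).indicator h := by
    funext y
    by_cases hy : y = 0
    · subst hy; simp
    · simp [hy]
  rw [hrw, lintegral_indicator (measurableSet_singleton 0), toMeasure_def,
    Measure.restrict_restrict (measurableSet_singleton 0),
    inter_eq_left.2 (singleton_subset_iff.2 S.2.1), Measure.restrict_singleton, Measure.count_singleton,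
    one_smul, lintegral_dirac]

/-- **The lazy re-rooting operator as a fibre integral against the Campbell weight**: for every rooted
`δ`-hard-core configuration `S` and measurable `f ≥ 0`,
`Σ_{y∈S} (w(y) + (1 − Σ_z w(z)) 1[y=0]) f((Θ(S,y)).1) = Σ_{y∈S} w(y) f(S−y) + (1 − Σ_z w(z)) f(S)`. [folklore] -/
theorem lintegral_campbellWeight_mul_reroot {w : EuclideanSpace ℝ (Fin 3) → ℝ≥0∞} (hw : Measurable w)
    {f : RootedHardCoreConfig (EuclideanSpace ℝ (Fin 3)) δ → ℝ≥0∞} (hf : Measurable f) [Fact (0 < δ)]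
    (S : RootedHardCoreConfig (EuclideanSpace ℝ (Fin 3)) δ) :
    ∫⁻ y, (w y + (1 - ∫⁻ z, w z ∂((S.1 : LocalConfig (EuclideanSpace ℝ (Fin 3))).toMeasure)) *
        ({(0 : EuclideanSpace ℝ (Fin 3))} : Set (EuclideanSpace ℝ (Fin 3))).indicator (fun _ => (1 : ℝ≥0∞)) y) *
      f ((fun p : RootedHardCoreConfig (EuclideanSpace ℝ (Fin 3)) δ × EuclideanSpace ℝ (Fin 3) =>
        ((if h : p.2 ∈ ((p.1.1 : LocalConfig (EuclideanSpace ℝ (Fin 3))) : Set (EuclideanSpace ℝ (Fin 3)))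
          then p.1.reroot p.2 h else p.1 : RootedHardCoreConfig (EuclideanSpace ℝ (Fin 3)) δ), -p.2)) (S, y)).1
      ∂((S.1 : LocalConfig (EuclideanSpace ℝ (Fin 3))).toMeasure) =
    (∫⁻ y, w y *
      f ((fun p : RootedHardCoreConfig (EuclideanSpace ℝ (Fin 3)) δ × EuclideanSpace ℝ (Fin 3) =>
        ((if h : p.2 ∈ ((p.1.1 : LocalConfig (EuclideanSpace ℝ (Fin 3))) : Set (EuclideanSpace ℝ (Fin 3)))
          then p.1.reroot p.2 h else p.1 : RootedHardCoreConfig (EuclideanSpace ℝ (Fin 3)) δ), -p.2)) (S, y)).1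
      ∂((S.1 : LocalConfig (EuclideanSpace ℝ (Fin 3))).toMeasure)) +
      (1 - ∫⁻ y, w y ∂((S.1 : LocalConfig (EuclideanSpace ℝ (Fin 3))).toMeasure)) * f S := by
  have hδ : 0 < δ := Fact.out
  have hΘ : Measurable (fun p : RootedHardCoreConfig (EuclideanSpace ℝ (Fin 3)) δ × EuclideanSpace ℝ (Fin 3) =>
      ((if h : p.2 ∈ ((p.1.1 : LocalConfig (EuclideanSpace ℝ (Fin 3))) : Set (EuclideanSpace ℝ (Fin 3)))
        then p.1.reroot p.2 h else p.1 : RootedHardCoreConfig (EuclideanSpace ℝ (Fin 3)) δ), -p.2)) :=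
    measurable_reroot hδ
  set Θ' : RootedHardCoreConfig (EuclideanSpace ℝ (Fin 3)) δ × EuclideanSpace ℝ (Fin 3) →
      RootedHardCoreConfig (EuclideanSpace ℝ (Fin 3)) δ × EuclideanSpace ℝ (Fin 3) :=
    fun p => ((if h : p.2 ∈ ((p.1.1 : LocalConfig (EuclideanSpace ℝ (Fin 3))) : Set (EuclideanSpace ℝ (Fin 3)))
      then p.1.reroot p.2 h else p.1 : RootedHardCoreConfig (EuclideanSpace ℝ (Fin 3)) δ), -p.2) with hΘ'_def
  have hfΘ : Measurable fun y : EuclideanSpace ℝ (Fin 3) => f (Θ' (S, y)).1 :=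
    hf.comp (hΘ.comp measurable_prodMk_left).fst
  have hS0 : (0 : EuclideanSpace ℝ (Fin 3)) ∈ ((S.1 : LocalConfig (EuclideanSpace ℝ (Fin 3))) :
      Set (EuclideanSpace ℝ (Fin 3))) := S.2.1
  have h0 : (Θ' (S, 0)).1 = S := by
    simp only [hΘ'_def]
    rw [dif_pos hS0, reroot_zero]
  simp_rw [add_mul]
  rw [lintegral_add_left (hw.fun_mul hfΘ)]
  congr 1
  simp_rw [mul_assoc]
  rw [lintegral_const_mul _ ((measurable_const.indicator (measurableSet_singleton 0)).fun_mul hfΘ),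
    lintegral_indicator_zero_mul, h0]

/-- **Matrix elements of the lazy re-rooting operator are weighted Campbell integrals** (`δ > 0`):
`∫ g(S) (P f)(S) dν(S) = ∫ g(p.1) f((Θ p).1) d((ν ⊗ₘ κ₀).withDensity W)(p)` for measurable `f, g ≥ 0` — the
function-level form of `P = E† ∘ U ∘ E` (`E f = f ∘ p₁`, `U h = h ∘ Θ`). [folklore] -/
theorem lintegral_mul_lazyReroot_eq_lintegral_withDensity [Fact (0 < δ)]
    (ν : Measure (RootedHardCoreConfig (EuclideanSpace ℝ (Fin 3)) δ)) [SFinite ν]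
    {w : EuclideanSpace ℝ (Fin 3) → ℝ≥0∞} (hw : Measurable w)
    {f g : RootedHardCoreConfig (EuclideanSpace ℝ (Fin 3)) δ → ℝ≥0∞} (hf : Measurable f) (hg : Measurable g) :
    ∫⁻ S, g S * ((∫⁻ y, w y *
      f ((fun p : RootedHardCoreConfig (EuclideanSpace ℝ (Fin 3)) δ × EuclideanSpace ℝ (Fin 3) =>
        ((if h : p.2 ∈ ((p.1.1 : LocalConfig (EuclideanSpace ℝ (Fin 3))) : Set (EuclideanSpace ℝ (Fin 3)))
          then p.1.reroot p.2 h else p.1 : RootedHardCoreConfig (EuclideanSpace ℝ (Fin 3)) δ), -p.2)) (S, y)).1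
      ∂((S.1 : LocalConfig (EuclideanSpace ℝ (Fin 3))).toMeasure)) +
      (1 - ∫⁻ y, w y ∂((S.1 : LocalConfig (EuclideanSpace ℝ (Fin 3))).toMeasure)) * f S) ∂ν =
    ∫⁻ p, g p.1 *
      f ((fun p : RootedHardCoreConfig (EuclideanSpace ℝ (Fin 3)) δ × EuclideanSpace ℝ (Fin 3) =>
        ((if h : p.2 ∈ ((p.1.1 : LocalConfig (EuclideanSpace ℝ (Fin 3))) : Set (EuclideanSpace ℝ (Fin 3)))
          then p.1.reroot p.2 h else p.1 : RootedHardCoreConfig (EuclideanSpace ℝ (Fin 3)) δ), -p.2)) p).1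
      ∂(haveI := isSFiniteKernel_toMeasure (E := EuclideanSpace ℝ (Fin 3)) (δ := δ)
        (ν ⊗ₘ (⟨fun S : RootedHardCoreConfig (EuclideanSpace ℝ (Fin 3)) δ =>
          (S.1 : LocalConfig (EuclideanSpace ℝ (Fin 3))).toMeasure,
          measurable_toMeasure (Fact.out : 0 < δ)⟩ :
          Kernel (RootedHardCoreConfig (EuclideanSpace ℝ (Fin 3)) δ) (EuclideanSpace ℝ (Fin 3)))).withDensity
        (fun p : RootedHardCoreConfig (EuclideanSpace ℝ (Fin 3)) δ × EuclideanSpace ℝ (Fin 3) =>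
          w p.2 + (1 - ∫⁻ z, w z ∂((p.1.1 : LocalConfig (EuclideanSpace ℝ (Fin 3))).toMeasure)) *
            ({(0 : EuclideanSpace ℝ (Fin 3))} : Set (EuclideanSpace ℝ (Fin 3))).indicator
              (fun _ => (1 : ℝ≥0∞)) p.2)) := by
  haveI := isSFiniteKernel_toMeasure (E := EuclideanSpace ℝ (Fin 3)) (δ := δ)
  have hδ : 0 < δ := Fact.out
  have hΘ : Measurable (fun p : RootedHardCoreConfig (EuclideanSpace ℝ (Fin 3)) δ × EuclideanSpace ℝ (Fin 3) =>
      ((if h : p.2 ∈ ((p.1.1 : LocalConfig (EuclideanSpace ℝ (Fin 3))) : Set (EuclideanSpace ℝ (Fin 3)))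
        then p.1.reroot p.2 h else p.1 : RootedHardCoreConfig (EuclideanSpace ℝ (Fin 3)) δ), -p.2)) :=
    measurable_reroot hδ
  have hpt := fun S => lintegral_campbellWeight_mul_reroot (δ := δ) hw hf S
  set Θ' : RootedHardCoreConfig (EuclideanSpace ℝ (Fin 3)) δ × EuclideanSpace ℝ (Fin 3) →
      RootedHardCoreConfig (EuclideanSpace ℝ (Fin 3)) δ × EuclideanSpace ℝ (Fin 3) :=
    fun p => ((if h : p.2 ∈ ((p.1.1 : LocalConfig (EuclideanSpace ℝ (Fin 3))) : Set (EuclideanSpace ℝ (Fin 3)))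
      then p.1.reroot p.2 h else p.1 : RootedHardCoreConfig (EuclideanSpace ℝ (Fin 3)) δ), -p.2) with hΘ'_def
  set W : RootedHardCoreConfig (EuclideanSpace ℝ (Fin 3)) δ × EuclideanSpace ℝ (Fin 3) → ℝ≥0∞ :=
    fun p => w p.2 + (1 - ∫⁻ z, w z ∂((p.1.1 : LocalConfig (EuclideanSpace ℝ (Fin 3))).toMeasure)) *
      ({(0 : EuclideanSpace ℝ (Fin 3))} : Set (EuclideanSpace ℝ (Fin 3))).indicator (fun _ => (1 : ℝ≥0∞)) p.2
    with hW_def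
  have hW : Measurable W :=
    (hw.comp measurable_snd).add ((measurable_const.sub ((measurable_lintegral_weight hw).comp measurable_fst)).mul
      ((measurable_const.indicator (measurableSet_singleton 0)).comp measurable_snd))
  have hG : Measurable fun p : RootedHardCoreConfig (EuclideanSpace ℝ (Fin 3)) δ × EuclideanSpace ℝ (Fin 3) =>
      g p.1 * f (Θ' p).1 := (hg.comp measurable_fst).mul (hf.comp hΘ.fst)
  rw [lintegral_withDensity_eq_lintegral_mul _ hW hG, Measure.lintegral_compProd (hW.mul hG)]
  refine lintegral_congr fun S => ?_
  rw [← hpt S]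
  have hmeas : Measurable fun y : EuclideanSpace ℝ (Fin 3) => W (S, y) * f (Θ' (S, y)).1 :=
    (hW.comp measurable_prodMk_left).mul (hf.comp (hΘ.comp measurable_prodMk_left).fst)
  rw [← lintegral_const_mul _ hmeas]
  refine lintegral_congr fun y => ?_
  simp only [hW_def, Pi.mul_apply]
  ring

end Summit.AtomisticToContinuum.Crystallization.Theorems.FrustratedLawDichotomyErgodicReduction

end
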